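import Mathlib.Algebra.MvPolynomial.Division
import Literature.Computability.AlgebraicComplexity.GKKP11SymmetricRepresentations
import Literature.Computability.AlgebraicComplexity.SymmetricDetRepresentationProofs
import HarnessLib

/-!
# Proof of GKKP 2011, Theorem 7 (discharge of the named fact `GKKP2011_thm7`)

Discharge (D-0014) of `Literature.Computability.AlgebraicComplexity.GKKP2011_thm7`
(`GKKP11SymmetricRepresentations.lean`): B. Grenet, E. L. Kaltofen, P. Koiran, N. Portier,
*Symmetric determinantal representation of formulas and weakly skew circuits*, Contemp. Math. 556
(2011) 61–96 = arXiv:1007.3804, §4, **Theorem 7** (read as the held text `paper:arxiv-1007.3804`,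
p0016–p0017): "Let `p` be a degree-`d` polynomial in `n` variables over a field `k` of
characteristic different from `2`. Then `p` admits a formula of skinny size
`F(n,d) ≤ C(n+d+1,n+1) - C(n+d-1,n+1) - 2`. This yields a symmetric determinantal representation
of dimensions `S(n,d) ≤ 4·C(n+d-1,n) - 2`." — in the typed form of the fact: (a) an `ArithExpr`
of GREEN size `≤ C(n+d+1,n+1) - C(n+d-1,n+1) - 2` (the printed formula is a weighted one, wire
weights = free multiplications by constants), (b) `HasSymmDetRepr p s` for some
`s ≤ 4·C(n+d-1,n) - 2` (symmetric matrix of affine linear forms: the print allows "linear functions"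
as inputs, p0017), for `p` of total degree `≤ d`, `d ≥ 1`.

## The printed proof and how it is followed

* **Eq. (4) (p0016)**: "`P_{n,d} = x_n · P_{n,d-1} + P_{n-1,d}`" with `P_{n,d-1}` of degree `≤ d-1`
  and `P_{n-1,d}` of degree `≤ d` without `x_n`; leaves `P_{k,1} = a_0 + a_1x_1 + ⋯ + a_kx_k` and
  `P_{0,δ}` (a constant: "a single input labelled by `1` with the constant `p_0` on the wire … So
  `F(0,δ) = 0`"). Here: `Thm7.exists_X_mul_add` (division with remainder by the monomial `x_i`,
  Mathlib's `divMonomial`/`modMonomial`), stated for a polynomial in the variables of a finite set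
  `S` (`p.vars ⊆ S`), so that "`n-1` variables" is `S.erase i`.
* **First part, `F(n,d)` (p0016–p0017)**: "`F(n,d) ≤ F(n-1,d) + F(n,d-1) + 2` … `G(N,d)` satisfies
  Pascal's formula" and the leaf count giving `C(n+d+1,n+1) - C(n+d-1,n+1) - 2`. Here:
  `Thm7.exists_formula_aux`, an induction on `|S| + d` building the formula
  `x_i × φ_q + φ_r` along eq. (4) and carrying the bound ADDITIVELY
  (`gsize + C(|S|+d-1,|S|+1) + 2 ≤ C(|S|+d+1,|S|+1)`); this closed form satisfies the printed
  recursion with equality (Pascal's rule twice), with the printed base cases `F(k,1) = k`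
  (the formula `a_0 + a_1·x_1 + ⋯ + a_k·x_k`, built one variable at a time by the same recursion with
  `d = 1`, the quotients being constants) and `F(0,δ) = 0`. So the leaf-counting paragraph of the
  print (the sets `W_{i,j}`) is replaced by checking that the announced bound solves the recursion —
  same recursion, same result. `Thm7.exists_formula` specialises to `S = Fin n`.
* **Second part, `S(n,d)` (p0017)**: the print makes the linear leaves `P_{k,1}` free ("the inputs
  of the formula are not only constants and variables, but also linear functions"), counts them
  (`C(n+d-1,d)` saved additions) and applies "Theorem (greensym)" = Thm. 3 (green size `e` ⇒
  symmetric matrix of dimension `2e+3`, the graph construction of Lemma 3) followed by "Pascal's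
  formula twice". Thm. 3 is the (undischarged) named fact `GKKP2011_thm3`; we do NOT use it.
  DEVIATION (a shorter road the tree already provides): the formula of eq. (4) with free affine
  leaves is a series–parallel BRANCHING PROGRAM — `p = x_i · q + r` is "an edge `x_i` from the source
  to a new vertex `v`, `q`'s program from `v`, `r`'s program in parallel", an affine leaf is a single
  source–sink edge — and a branching program is symmetrised ALGEBRAICALLY exactly as in the tree's
  proof of GKKP Thm. 5 (`SymmetricDetRepresentationProofs.lean`: vertex doubling `midBlock`, border
  `borderBlock`, explicit inverse `midInv`, Schur complement `det_symOfABP`), here with one more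
  corner entry for the direct source–sink edge (`Thm7.det_cornerBorderMid`:
  `det = (-1)^{|V|} · 2εη · (m - a(1+N)⁻¹b)`). The program for `p` of degree `≤ d` in `n ≥ 1`
  variables, `d ≥ 2`, has `|V| ≤ C(n+d-1,n) - 1` internal vertices (`Thm7.exists_abp_aux`: the
  recursion `|V(n,d)| + 1 = (|V(n,d-1)| + 1) + (|V(n-1,d)| + 1)` is Pascal's rule on the nose, leaves
  contributing `1 = C(·,·)`), so the symmetric matrix has dimension `2|V| + 3 ≤ 2·C(n+d-1,n) + 1`,
  which is `≤ 4·C(n+d-1,n) - 2` as printed (`C(n+d-1,n) ≥ n+1 ≥ 2`); for `n = 0` or `d = 1` the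
  polynomial is affine and `(p)` is a symmetric `1 × 1` representation (`1 ≤ 4·C - 2`). Entries:
  `0, ±1, 1/2`, variables, the affine leaves and their negatives, `1 + N` — all affine, as
  `HasSymmDetRepr` requires. The invariants carried through the recursion are the explicit inverse
  `G` of `1 + N` (block upper-triangular, `Thm7.seriesParallel_mul_inv`), `det (1 + N) = 1`
  (`Thm7.seriesParallel_det`) and the value `w + a G b = p` (`Thm7.seriesParallel_value`).

Part (a) holds over any commutative semiring; part (b) uses `2 ≠ 0` in `k` exactly once (the
weight `1/2` at GKKP's vertex `c`). No new definitions and no new named facts (D-0026): the file is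
theorems only; the matrices are written with Mathlib's `Matrix.fromBlocks` and the tree's blocks.
Honest framing: bookkeeping for rung V1 of the `ValiantsHypothesis` ladder (the symmetric-pencil
dictionary); `VP ≠ VNP` is NOT proved and nothing here is progress on it.

## References

* [GrenetEtAl2011] B. Grenet, E. L. Kaltofen, P. Koiran, N. Portier, Contemp. Math. 556 (2011)
  61–96 = arXiv:1007.3804, §4 Thm. 7 and its proof (held text `paper:arxiv-1007.3804`,
  p0016–p0017); §3.2 Thm. 5 (proof) for the symmetrisation blocks.
* [MalodPortier2008] G. Malod, N. Portier, J. Complexity 24 (2008) (branching programs /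
  weakly-skew circuits and determinants; background for the series–parallel program).
-/

noncomputable section

namespace Literature.Computability.AlgebraicComplexity

open MvPolynomial Matrix Finset

namespace GKKP2011

namespace Thm7

/-! ## Step D. The recursion `P_{n,d} = x_n · P_{n,d-1} + P_{n-1,d}` (GKKP eq. (4), p0016) -/

section Decomp

variable {k : Type*} [CommSemiring k] {σ : Type*}

/-- Degree of a shifted exponent: `|m + e_i| = |m| + 1`. [folklore] -/
private theorem degree_add_single (m : σ →₀ ℕ) (i : σ) :
    ((Finsupp.single i 1 + m).sum fun _ e => e) = (m.sum fun _ e => e) + 1 := by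
  rw [Finsupp.sum_add_index' (fun _ => rfl) (fun _ _ _ => rfl), Finsupp.sum_single_index rfl]
  omega

/-- A polynomial involving no variable is a constant. [folklore] -/
private theorem eq_C_of_vars_subset_empty {p : MvPolynomial σ k} (hS : p.vars ⊆ ∅) :
    p = C (coeff 0 p) := by
  rw [← totalDegree_eq_zero_iff_eq_C, totalDegree]
  refine Nat.eq_zero_of_le_zero (Finset.sup_le fun m hm => ?_)
  have hm0 : m = 0 := by
    ext j
    by_contra hj
    have : j ∈ p.vars := (mem_vars_iff_mem_support j).2 ⟨m, hm, Finsupp.mem_support_iff.2 hj⟩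
    exact Finset.notMem_empty j (hS this)
  simp [hm0]

variable [DecidableEq σ]

/-- **GKKP 2011, eq. (4) of the proof of Thm. 7 (p0016)**: "`P_{n,d} = x_n · P_{n,d-1} + P_{n-1,d}`"
with "`P_{n,d-1}` a polynomial of degree at most `d-1`" in the same variables and "`P_{n-1,d}` a
polynomial of degree at most `d`" not involving `x_n` — division with remainder by the monomial
`x_i` (Mathlib's `divMonomial` / `modMonomial`). [cite: GrenetEtAl2011, Thm 7 (proof, eq. (4))] -/
theorem exists_X_mul_add (p : MvPolynomial σ k) (i : σ) {S : Finset σ} (hS : p.vars ⊆ S)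
    {e : ℕ} (he : p.totalDegree ≤ e + 1) :
    ∃ q r : MvPolynomial σ k, X i * q + r = p ∧ q.vars ⊆ S ∧ q.totalDegree ≤ e ∧
      r.vars ⊆ S.erase i ∧ r.totalDegree ≤ e + 1 := by
  set q := p.divMonomial (Finsupp.single i 1) with hq_def
  set r := p.modMonomial (Finsupp.single i 1) with hr_def
  have hqs : ∀ m ∈ q.support, Finsupp.single i 1 + m ∈ p.support := by
    intro m hm
    rw [mem_support_iff] at hm ⊢
    rwa [hq_def, coeff_divMonomial] at hm
  have hrs : ∀ m ∈ r.support, m ∈ p.support ∧ m i = 0 := by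
    intro m hm
    rw [mem_support_iff] at hm
    by_cases hle : Finsupp.single i 1 ≤ m
    · exact absurd (coeff_modMonomial_of_le p hle) hm
    · refine ⟨?_, ?_⟩
      · rw [mem_support_iff, ← coeff_modMonomial_of_not_le p hle]
        exact hm
      · rw [Finsupp.single_le_iff] at hle
        omega
  refine ⟨q, r, divMonomial_add_modMonomial_single p i, ?_, ?_, ?_, ?_⟩
  · intro j hj
    obtain ⟨m, hm, hjm⟩ := (mem_vars_iff_mem_support j).1 hj
    refine hS ((mem_vars_iff_mem_support j).2 ⟨_, hqs m hm, ?_⟩)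
    rw [Finsupp.mem_support_iff] at hjm ⊢
    rw [Finsupp.add_apply]
    omega
  · rw [totalDegree]
    refine Finset.sup_le fun m hm => ?_
    have h := le_totalDegree (hqs m hm)
    rw [degree_add_single] at h
    omega
  · intro j hj
    obtain ⟨m, hm, hjm⟩ := (mem_vars_iff_mem_support j).1 hj
    obtain ⟨hmp, hmi⟩ := hrs m hm
    rw [Finset.mem_erase]
    refine ⟨?_, hS ((mem_vars_iff_mem_support j).2 ⟨m, hmp, hjm⟩)⟩
    rintro rfl
    exact (Finsupp.mem_support_iff.1 hjm) hmi
  · exact (totalDegree_le_of_support_subset fun m hm => (hrs m hm).1).trans he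

end Decomp

/-! ## Step A. The formula (GKKP Thm. 7, first part: `F(n,d)`) -/

section Formula

variable {k : Type*} {σ : Type*}

/-- `gsize(x × φ) ≤ gsize(φ) + 1` (equality unless `φ` is a constant input, when it is `0`).
[cite: GrenetEtAl2011, Def 6] -/
theorem greenSize_var_mul_le (i : σ) (φ : ArithExpr k σ) :
    (ArithExpr.mul (.var i) φ).greenSize ≤ φ.greenSize + 1 := by
  simp only [ArithExpr.greenSize, ArithExpr.isConstInput]
  split_ifs <;> simp

variable [CommSemiring k] [DecidableEq σ]

/-- **The recursion tree of GKKP's proof of Thm. 7, with the Pascal count (p0016–p0017)**: a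
polynomial of total degree `≤ e + 1` in the variables `S` has a formula of green size `g` with
`g + C(|S|+e, |S|+1) + 2 ≤ C(|S|+e+2, |S|+1)` — i.e. `g ≤ F(|S|, e+1)` in the printed notation,
stated additively (no truncated subtraction). Leaves: constants (`P_{0,δ}`, free: "a single input
labelled by `1` with the constant `p_0` on the wire") and `P_{k,1} = a_0 + a_1x_1 + ⋯ + a_kx_k`
(`k` additions, the multiplications by the constants `a_j` being free). [cite: GrenetEtAl2011, Thm 7 (proof)] -/
theorem exists_formula_aux (M : ℕ) : ∀ (S : Finset σ) (e : ℕ) (p : MvPolynomial σ k),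
    S.card + e ≤ M → p.vars ⊆ S → p.totalDegree ≤ e + 1 →
    ∃ φ : ArithExpr k σ, φ.eval = p ∧
      φ.greenSize + (S.card + e).choose (S.card + 1) + 2 ≤ (S.card + e + 2).choose (S.card + 1) := by
  induction M with
  | zero =>
    intro S e p hM hS hp
    have hS0 : S = ∅ := Finset.card_eq_zero.1 (by omega)
    subst hS0
    refine ⟨.const (coeff 0 p), (eq_C_of_vars_subset_empty hS).symm, ?_⟩
    simp
  | succ M ih =>
    intro S e p hM hS hp
    rcases S.eq_empty_or_nonempty with hS0 | ⟨i, hi⟩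
    · subst hS0
      refine ⟨.const (coeff 0 p), (eq_C_of_vars_subset_empty hS).symm, ?_⟩
      simp
    obtain ⟨n', hn'⟩ : ∃ n', S.card = n' + 1 := ⟨S.card - 1, by
      have := Finset.card_pos.2 ⟨i, hi⟩; omega⟩
    have hcard : (S.erase i).card = n' := by rw [Finset.card_erase_of_mem hi]; omega
    obtain ⟨q, r, hpqr, hqS, hqd, hrS, hrd⟩ := exists_X_mul_add p i hS hp
    cases e with
    | zero =>
      -- `d = 1`: `q` is a constant, `p = x_i · c + r` with `r` affine in the other variables
      have hq : q = C (coeff 0 q) := totalDegree_eq_zero_iff_eq_C.1 (by omega)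
      obtain ⟨φr, hφr, hgr⟩ := ih (S.erase i) 0 r (by omega) hrS hrd
      refine ⟨.add (.mul (.var i) (.const (coeff 0 q))) φr, ?_, ?_⟩
      · simp only [ArithExpr.eval_add, ArithExpr.eval_mul, ArithExpr.eval_var, ArithExpr.eval_const,
          hφr, ← hq, hpqr]
      · rw [hcard] at hgr
        rw [hn']
        simp only [ArithExpr.greenSize_add, ArithExpr.greenSize_mul_const, ArithExpr.greenSize_var,
          add_zero, Nat.choose_succ_self, Nat.choose_succ_self_right] at hgr ⊢
        have h1 : (n' + 1 + 0 + 2).choose (n' + 1 + 1) = n' + 3 := by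
          rw [show n' + 1 + 0 + 2 = (n' + 2) + 1 by ring, Nat.choose_succ_self_right]
        have h2 : (n' + 1 + 0).choose (n' + 1 + 1) = 0 := by
          rw [show n' + 1 + 0 = n' + 1 by ring, Nat.choose_succ_self]
        omega
    | succ e =>
      obtain ⟨φq, hφq, hgq⟩ := ih S e q (by omega) hqS hqd
      obtain ⟨φr, hφr, hgr⟩ := ih (S.erase i) (e + 1) r (by omega) hrS hrd
      refine ⟨.add (.mul (.var i) φq) φr, ?_, ?_⟩
      · simp only [ArithExpr.eval_add, ArithExpr.eval_mul, ArithExpr.eval_var, hφq, hφr, hpqr]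
      · have hmul := greenSize_var_mul_le i φq
        rw [hcard] at hgr
        rw [hn'] at hgq ⊢
        simp only [ArithExpr.greenSize_add] at ⊢
        -- Pascal's rule twice (GKKP: "`G(N,d)` satisfies Pascal's formula")
        have P1 : (n' + 1 + (e + 1)).choose (n' + 1 + 1) =
            (n' + (e + 1)).choose (n' + 1) + (n' + 1 + e).choose (n' + 1 + 1) := by
          rw [show n' + 1 + (e + 1) = (n' + 1 + e) + 1 by ring,
            show n' + (e + 1) = n' + 1 + e by ring]
          exact Nat.choose_succ_succ' _ _
        have P2 : (n' + 1 + (e + 1) + 2).choose (n' + 1 + 1) =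
            (n' + (e + 1) + 2).choose (n' + 1) + (n' + 1 + e + 2).choose (n' + 1 + 1) := by
          rw [show n' + 1 + (e + 1) + 2 = (n' + 1 + e + 2) + 1 by ring,
            show n' + (e + 1) + 2 = n' + 1 + e + 2 by ring]
          exact Nat.choose_succ_succ' _ _
        omega

/-- **GKKP 2011, Theorem 7, first part** (p0016): a polynomial of total degree `≤ d` (`d ≥ 1`) in
`n` variables admits a formula of green size at most `C(n+d+1, n+1) - C(n+d-1, n+1) - 2`
(`ArithExpr.greenSize`: wire weights = free multiplications by constants). Holds over any
commutative semiring. [cite: GrenetEtAl2011, Thm 7] -/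
theorem exists_formula (n d : ℕ) (hd : 1 ≤ d) (p : MvPolynomial (Fin n) k)
    (hp : p.totalDegree ≤ d) :
    ∃ φ : ArithExpr k (Fin n), φ.eval = p ∧
      φ.greenSize ≤ (n + d + 1).choose (n + 1) - (n + d - 1).choose (n + 1) - 2 := by
  obtain ⟨e, rfl⟩ : ∃ e, d = e + 1 := ⟨d - 1, by omega⟩
  obtain ⟨φ, hφ, hg⟩ := exists_formula_aux (k := k) (n + e) Finset.univ e p
    (by simp) (Finset.subset_univ _) hp
  refine ⟨φ, hφ, ?_⟩
  simp only [Finset.card_univ, Fintype.card_fin] at hg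
  rw [show n + (e + 1) + 1 = n + e + 2 by ring, show n + (e + 1) - 1 = n + e by omega]
  omega

end Formula

/-! ## Step B. The series–parallel branching program of the recursion (for `S(n,d)`) -/

section ABP

variable {V : Type*} [Fintype V] [DecidableEq V] {R : Type*} [CommRing R]

/-- **Symmetrization with a direct source–sink edge** (the algebra of GKKP's graph `Ḡ`, as in the
tree's proof of Thm. 5, `det_symOfABP`, with one more entry): for a branching program with internal
adjacency data `N` (`(1+N) G = 1`, `det (1+N) = 1`), source/sink weights `a, b` and a corner block
`[[0, ε, η], [ε, 0, m], [η, m, 0]]` on `c, s_out, t_in` (`m` = weight of the edge `s_out — t_in`),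
the determinant is `(-1)^{|V|} · 2εη · (m - a G b)` (Schur complement of the unipotent middle
block). [cite: GrenetEtAl2011, Thm 5 (proof)] -/
theorem det_cornerBorderMid (N G : Matrix V V R) (hG : (1 + N) * G = 1) (hdet : (1 + N).det = 1)
    (a b : V → R) (ε η m : R) :
    (Matrix.fromBlocks !![0, ε, η; ε, 0, m; η, m, 0] (borderBlock a b) (borderBlock a b)ᵀ
      (midBlock N)).det = (-1) ^ Fintype.card V * (2 * ε * η * (m - abpValue G a b)) := by
  letI : Invertible (midBlock N) := invertibleOfRightInverse _ _ (midBlock_mul_midInv N G hG)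
  have hinv : ⅟(midBlock N) = midInv G := invOf_eq_right_inv (midBlock_mul_midInv N G hG)
  rw [det_fromBlocks₂₂, hinv, det_midBlock N G hG hdet, borderBlock_mul_midInv_mul_transpose]
  have hsub : !![0, ε, η; ε, 0, m; η, m, 0] - !![0, 0, 0; 0, 0, abpValue G a b; 0, abpValue G a b, 0]
      = !![0, ε, η; ε, 0, m - abpValue G a b; η, m - abpValue G a b, 0] := by
    ext i j
    fin_cases i <;> fin_cases j <;> simp
  rw [hsub, det_fin_three]
  simp
  ring

omit [Fintype V] in
/-- The matrix of `det_cornerBorderMid` is symmetric. [cite: GrenetEtAl2011, Thm 5 (proof)] -/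
theorem isSymm_cornerBorderMid (N : Matrix V V R) (a b : V → R) (ε η m : R) :
    (Matrix.fromBlocks !![0, ε, η; ε, 0, m; η, m, 0] (borderBlock a b) (borderBlock a b)ᵀ
      (midBlock N)).IsSymm := by
  refine Matrix.IsSymm.fromBlocks ?_ rfl (isSymm_midBlock N)
  refine Matrix.IsSymm.ext fun i j => ?_
  fin_cases i <;> fin_cases j <;> rfl

variable {Vq Vr : Type*} [Fintype Vq] [DecidableEq Vq] [Fintype Vr] [DecidableEq Vr]

/-- Series–parallel step `p = x · q + r` of the branching program (new vertex `v`: edge `s → v`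
of weight `x`, then `q`'s program started at `v`; `r`'s program in parallel): the explicit
inverse of `1 + N`. [folklore] -/
private theorem seriesParallel_mul_inv (Nq Gq : Matrix Vq Vq R) (hGq : (1 + Nq) * Gq = 1)
    (Nr Gr : Matrix Vr Vr R) (hGr : (1 + Nr) * Gr = 1) (aq : Vq → R) :
    (1 + Matrix.fromBlocks (Matrix.fromBlocks (0 : Matrix Unit Unit R)
        (Matrix.of fun _ v => -aq v) 0 Nq) 0 0 Nr) *
      Matrix.fromBlocks (Matrix.fromBlocks (1 : Matrix Unit Unit R)
        (Matrix.of fun _ v => (aq ᵥ* Gq) v) 0 Gq) 0 0 Gr = 1 := by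
  have hE : (Matrix.of fun (_ : Unit) v => (aq ᵥ* Gq) v) +
      (Matrix.of fun (_ : Unit) v => -aq v) * Gq = 0 := by
    ext u v
    simp [Matrix.mul_apply, vecMul, dotProduct, Finset.sum_neg_distrib]
  have h1 : (1 : Matrix (Unit ⊕ Vq) (Unit ⊕ Vq) R) = Matrix.fromBlocks 1 0 0 1 :=
    (Matrix.fromBlocks_one).symm
  have h2 : (1 : Matrix ((Unit ⊕ Vq) ⊕ Vr) ((Unit ⊕ Vq) ⊕ Vr) R) = Matrix.fromBlocks 1 0 0 1 :=
    (Matrix.fromBlocks_one).symm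
  rw [h2, fromBlocks_add, fromBlocks_multiply, h1, fromBlocks_add, fromBlocks_multiply]
  simp [hGq, hGr, hE]

/-- Series–parallel step: `1 + N` stays unipotent. [folklore] -/
private theorem seriesParallel_det (Nq : Matrix Vq Vq R) (hq : (1 + Nq).det = 1)
    (Nr : Matrix Vr Vr R) (hr : (1 + Nr).det = 1) (aq : Vq → R) :
    (1 + Matrix.fromBlocks (Matrix.fromBlocks (0 : Matrix Unit Unit R)
        (Matrix.of fun _ v => -aq v) 0 Nq) 0 0 Nr).det = 1 := by
  have h1 : (1 : Matrix (Unit ⊕ Vq) (Unit ⊕ Vq) R) = Matrix.fromBlocks 1 0 0 1 :=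
    (Matrix.fromBlocks_one).symm
  have h2 : (1 : Matrix ((Unit ⊕ Vq) ⊕ Vr) ((Unit ⊕ Vq) ⊕ Vr) R) = Matrix.fromBlocks 1 0 0 1 :=
    (Matrix.fromBlocks_one).symm
  rw [h2, fromBlocks_add, add_zero, add_zero, det_fromBlocks_zero₂₁, h1, fromBlocks_add, add_zero,
    add_zero, det_fromBlocks_zero₂₁, hq, hr, det_one]
  ring

omit [DecidableEq Vq] [DecidableEq Vr] in
/-- Series–parallel step: the value of the new program is `x · (w_q + a_q G_q b_q) + a_r G_r b_r`
(`w_q` = the direct edge of `q`'s program, now the edge `v → t`). [folklore] -/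
private theorem seriesParallel_value (Gq : Matrix Vq Vq R) (Gr : Matrix Vr Vr R) (aq bq : Vq → R)
    (ar br : Vr → R) (x wq : R) :
    abpValue (Matrix.fromBlocks (Matrix.fromBlocks (1 : Matrix Unit Unit R)
        (Matrix.of fun _ v => (aq ᵥ* Gq) v) 0 Gq) 0 0 Gr)
      (Sum.elim (Sum.elim (fun _ => x) 0) ar) (Sum.elim (Sum.elim (fun _ => wq) bq) br) =
      x * (wq + abpValue Gq aq bq) + abpValue Gr ar br := by
  simp only [abpValue, fromBlocks_mulVec, Sum.elim_comp_inl, Sum.elim_comp_inr, zero_mulVec,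
    add_zero, zero_add, sumElim_dotProduct_sumElim, zero_dotProduct, one_mulVec]
  rw [dotProduct_mulVec aq Gq bq]
  simp [dotProduct, mulVec, vecMul, Finset.mul_sum, mul_add]

omit [DecidableEq Vq] [DecidableEq Vr] in
/-- Series–parallel step: one new vertex. [folklore] -/
private theorem card_seriesParallel :
    Fintype.card ((Unit ⊕ Vq) ⊕ Vr) = Fintype.card Vq + Fintype.card Vr + 1 := by
  simp only [Fintype.card_sum, Fintype.card_unit]
  ring

end ABP

section Affine

variable {k : Type*} [CommRing k] {σ : Type*}

/-- Entries of the identity matrix are affine. [folklore] -/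
private theorem totalDegree_one_apply_le {V : Type*} [DecidableEq V] (u v : V) :
    ((1 : Matrix V V (MvPolynomial σ k)) u v).totalDegree ≤ 1 := by
  rw [Matrix.one_apply]
  split_ifs <;> simp

/-- A block matrix with affine blocks is affine. [folklore] -/
private theorem totalDegree_fromBlocks_le {l m n o : Type*} {A : Matrix n l (MvPolynomial σ k)}
    {B : Matrix n m (MvPolynomial σ k)} {C' : Matrix o l (MvPolynomial σ k)}
    {D : Matrix o m (MvPolynomial σ k)} (hA : ∀ i j, (A i j).totalDegree ≤ 1)
    (hB : ∀ i j, (B i j).totalDegree ≤ 1) (hC : ∀ i j, (C' i j).totalDegree ≤ 1)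
    (hD : ∀ i j, (D i j).totalDegree ≤ 1) :
    ∀ i j, (Matrix.fromBlocks A B C' D i j).totalDegree ≤ 1 := by
  rintro (i | i) (j | j)
  · simpa using hA i j
  · simpa using hB i j
  · simpa using hC i j
  · simpa using hD i j

/-- A juxtaposition of affine vectors is affine. [folklore] -/
private theorem totalDegree_sumElim_le {m n : Type*} {a : m → MvPolynomial σ k}
    {b : n → MvPolynomial σ k} (ha : ∀ i, (a i).totalDegree ≤ 1)
    (hb : ∀ i, (b i).totalDegree ≤ 1) : ∀ i, (Sum.elim a b i).totalDegree ≤ 1 := by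
  rintro (i | i)
  · simpa using ha i
  · simpa using hb i

variable [DecidableEq σ]

/-- The branching programs of the recursion (existential form used in the induction): internal
vertices `V`, adjacency data `N` with explicit inverse `G` of `1 + N` and `det (1 + N) = 1`,
affine source/sink weights `a, b`, a direct source–sink edge `w`, computing `w + a G b = p`, with
`|V| + 1 ≤ C(|S| + e, |S|)` for `p` of degree `≤ e + 1` in the variables `S` — the count of the
linear-function leaves `P_{k,1}` of GKKP's recursion tree ("the number of leaves labelled by
`P_{k,1}` is the cardinality of `W_{n-k,d-2}`", p0017), here as internal vertices = multiplication
gates. Affine `p` (a leaf): the empty program with the direct edge `p`. [cite: GrenetEtAl2011, Thm 7 (proof)] -/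
theorem exists_abp_aux (M : ℕ) : ∀ (S : Finset σ) (e : ℕ) (p : MvPolynomial σ k),
    S.card + e ≤ M → p.vars ⊆ S → p.totalDegree ≤ e + 1 →
    ∃ (V : Type) (_ : Fintype V) (_ : DecidableEq V) (N G : Matrix V V (MvPolynomial σ k))
      (a b : V → MvPolynomial σ k) (w : MvPolynomial σ k),
      Fintype.card V + 1 ≤ (S.card + e).choose S.card ∧ (1 + N) * G = 1 ∧ (1 + N).det = 1 ∧
      (∀ u v, (N u v).totalDegree ≤ 1) ∧ (∀ u, (a u).totalDegree ≤ 1) ∧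
      (∀ u, (b u).totalDegree ≤ 1) ∧ w.totalDegree ≤ 1 ∧ w + abpValue G a b = p := by
  -- the leaf: an affine `p` is the empty program with direct edge `p`
  have leaf : ∀ (S : Finset σ) (e : ℕ) (p : MvPolynomial σ k), p.totalDegree ≤ 1 →
      ∃ (V : Type) (_ : Fintype V) (_ : DecidableEq V) (N G : Matrix V V (MvPolynomial σ k))
        (a b : V → MvPolynomial σ k) (w : MvPolynomial σ k),
        Fintype.card V + 1 ≤ (S.card + e).choose S.card ∧ (1 + N) * G = 1 ∧ (1 + N).det = 1 ∧
        (∀ u v, (N u v).totalDegree ≤ 1) ∧ (∀ u, (a u).totalDegree ≤ 1) ∧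
        (∀ u, (b u).totalDegree ≤ 1) ∧ w.totalDegree ≤ 1 ∧ w + abpValue G a b = p := by
    intro S e p hp
    refine ⟨Fin 0, inferInstance, inferInstance, 0, 0, Fin.elim0, Fin.elim0, p, ?_,
      Subsingleton.elim _ _, Matrix.det_isEmpty, fun u => u.elim0, fun u => u.elim0,
      fun u => u.elim0, hp, ?_⟩
    · have := Nat.choose_pos (show S.card ≤ S.card + e by omega)
      simp only [Fintype.card_fin]
      omega
    · simp [abpValue, dotProduct]
  induction M with
  | zero =>
    intro S e p hM hS hp
    have he : e = 0 := by omega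
    subst he
    exact leaf S 0 p hp
  | succ M ih =>
    intro S e p hM hS hp
    cases e with
    | zero => exact leaf S 0 p hp
    | succ e =>
      rcases S.eq_empty_or_nonempty with hS0 | ⟨i, hi⟩
      · subst hS0
        refine leaf ∅ (e + 1) p ?_
        rw [eq_C_of_vars_subset_empty hS, totalDegree_C]
        exact Nat.zero_le _
      obtain ⟨n', hn'⟩ : ∃ n', S.card = n' + 1 := ⟨S.card - 1, by
        have := Finset.card_pos.2 ⟨i, hi⟩; omega⟩
      have hcard : (S.erase i).card = n' := by rw [Finset.card_erase_of_mem hi]; omega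
      obtain ⟨q, r, hpqr, hqS, hqd, hrS, hrd⟩ := exists_X_mul_add p i hS hp
      obtain ⟨Vq, _, _, Nq, Gq, aq, bq, wq, hcq, hGq, hdq, hNq, haq, hbq, hwq, hvq⟩ :=
        ih S e q (by omega) hqS hqd
      obtain ⟨Vr, _, _, Nr, Gr, ar, br, wr, hcr, hGr, hdr, hNr, har, hbr, hwr, hvr⟩ :=
        ih (S.erase i) (e + 1) r (by omega) hrS hrd
      refine ⟨(Unit ⊕ Vq) ⊕ Vr, inferInstance, inferInstance,
        Matrix.fromBlocks (Matrix.fromBlocks (0 : Matrix Unit Unit (MvPolynomial σ k))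
          (Matrix.of fun _ v => -aq v) 0 Nq) 0 0 Nr,
        Matrix.fromBlocks (Matrix.fromBlocks (1 : Matrix Unit Unit (MvPolynomial σ k))
          (Matrix.of fun _ v => (aq ᵥ* Gq) v) 0 Gq) 0 0 Gr,
        Sum.elim (Sum.elim (fun _ => X i) 0) ar, Sum.elim (Sum.elim (fun _ => wq) bq) br, wr,
        ?_, seriesParallel_mul_inv Nq Gq hGq Nr Gr hGr aq, seriesParallel_det Nq hdq Nr hdr aq,
        ?_, ?_, ?_, hwr, ?_⟩
      · -- Pascal's rule: `C(n'+e+2, n'+1) = C(n'+e+1, n') + C(n'+e+1, n'+1)`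
        rw [card_seriesParallel, hn']
        rw [hn'] at hcq
        rw [hcard] at hcr
        have P : (n' + 1 + (e + 1)).choose (n' + 1) =
            (n' + (e + 1)).choose n' + (n' + 1 + e).choose (n' + 1) := by
          rw [show n' + 1 + (e + 1) = (n' + 1 + e) + 1 by ring,
            show n' + (e + 1) = n' + 1 + e by ring]
          exact Nat.choose_succ_succ' _ _
        omega
      · refine totalDegree_fromBlocks_le (totalDegree_fromBlocks_le (by simp) ?_ (by simp) hNq)
          (by simp) (by simp) hNr
        intro u v
        simpa [totalDegree_neg] using haq v
      · refine totalDegree_sumElim_le (totalDegree_sumElim_le (fun _ => ?_) (by simp)) har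
        exact (isHomogeneous_X k i).totalDegree_le
      · exact totalDegree_sumElim_le (totalDegree_sumElim_le (fun _ => hwq) hbq) hbr
      · rw [seriesParallel_value, ← hpqr, ← hvq, ← hvr]
        ring

end Affine

/-! ## Step C. The symmetric matrix (GKKP Thm. 7, second part: `S(n,d)`) -/

section Symmetric

variable {k : Type*} [Field k] {σ : Type*}

/-- **From the branching program to a symmetric affine representation**: with the corner entries
`ε = (-1)^{|V|+1}`, `η = 1/2` and the direct edge entered as `-w`, the symmetric matrix of
`det_cornerBorderMid` has determinant exactly `w + a G b` and dimension `2|V| + 3`; all its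
entries (`0, ±1, 1/2`, the weights, `1 + N`) are affine. Needs `2 ≠ 0` in `k` (the `1/2` of
GKKP's vertex `c`). [cite: GrenetEtAl2011, Thm 7 (proof)] -/
theorem hasSymmDetRepr_of_abp (h2 : (2 : k) ≠ 0) {V : Type*} [Fintype V] [DecidableEq V]
    (N G : Matrix V V (MvPolynomial σ k)) (hG : (1 + N) * G = 1) (hdet : (1 + N).det = 1)
    (a b : V → MvPolynomial σ k) (w : MvPolynomial σ k) (hN : ∀ u v, (N u v).totalDegree ≤ 1)
    (ha : ∀ u, (a u).totalDegree ≤ 1) (hb : ∀ u, (b u).totalDegree ≤ 1)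
    (hw : w.totalDegree ≤ 1) :
    HasSymmDetRepr (w + abpValue G a b) (2 * Fintype.card V + 3) := by
  set ε : MvPolynomial σ k := C ((-1) ^ (Fintype.card V + 1)) with hε
  set η : MvPolynomial σ k := C 2⁻¹ with hη
  set Mat := Matrix.fromBlocks !![0, ε, η; ε, 0, -w; η, -w, 0] (borderBlock a b) (borderBlock a b)ᵀ
    (midBlock N) with hMat
  have hdetM : Mat.det = w + abpValue G a b := by
    rw [hMat, det_cornerBorderMid N G hG hdet a b ε η (-w), hε, hη]
    have hsq : ((-1 : MvPolynomial σ k) ^ Fintype.card V) * (-1) ^ (Fintype.card V + 1) = -1 := by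
      rw [← pow_add, show Fintype.card V + (Fintype.card V + 1) = 2 * Fintype.card V + 1 by ring,
        pow_succ, pow_mul, neg_one_sq, one_pow, one_mul]
    have hhalf : (2 : MvPolynomial σ k) * C (2⁻¹ : k) = 1 := by
      rw [show (2 : MvPolynomial σ k) = C 2 from (map_ofNat C 2).symm, ← C_mul,
        mul_inv_cancel₀ h2, C_1]
    simp only [map_pow, map_neg, map_one]
    linear_combination (2 * C (2⁻¹ : k) * (-w - abpValue G a b)) * hsq +
      (-(-w - abpValue G a b)) * hhalf
  have hcard : Fintype.card (Fin 3 ⊕ (V ⊕ V)) = 2 * Fintype.card V + 3 := by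
    simp only [Fintype.card_sum, Fintype.card_fin]
    ring
  let eqv : Fin 3 ⊕ (V ⊕ V) ≃ Fin (2 * Fintype.card V + 3) := Fintype.equivFinOfCardEq hcard
  have hentries : ∀ u v, (Mat u v).totalDegree ≤ 1 := by
    have hcorner : ∀ i j, (!![0, ε, η; ε, 0, -w; η, -w, 0] i j).totalDegree ≤ 1 := by
      have hε' : ε.totalDegree ≤ 1 := by rw [hε, totalDegree_C]; exact Nat.zero_le _
      have hη' : η.totalDegree ≤ 1 := by rw [hη, totalDegree_C]; exact Nat.zero_le _
      intro i j
      fin_cases i <;> fin_cases j <;> simp [hε', hη', hw]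
    have hborder : ∀ i uv, (borderBlock a b i uv).totalDegree ≤ 1 := by
      rintro i (u | u) <;> fin_cases i <;> simp [borderBlock, ha u, hb u]
    have hmid : ∀ u v, (midBlock N u v).totalDegree ≤ 1 := by
      refine totalDegree_fromBlocks_le (by simp) ?_ ?_ (by simp)
      · intro u v
        rw [Matrix.add_apply, Matrix.transpose_apply]
        exact (totalDegree_add _ _).trans (max_le (totalDegree_one_apply_le u v) (hN v u))
      · intro u v
        rw [Matrix.add_apply]
        exact (totalDegree_add _ _).trans (max_le (totalDegree_one_apply_le u v) (hN u v))
    exact totalDegree_fromBlocks_le hcorner hborder (fun uv i => hborder i uv) hmid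
  refine ⟨Mat.submatrix eqv.symm eqv.symm, (isSymm_cornerBorderMid N a b ε η (-w)).submatrix _,
    fun i j => ?_, ?_⟩
  · rw [Matrix.submatrix_apply]
    exact hentries _ _
  · rw [Matrix.det_submatrix_equiv_self, hdetM]

variable [DecidableEq σ]

/-- **GKKP 2011, Theorem 7, second part** (p0016–p0017), in the tree's vocabulary: a polynomial
of total degree `≤ d` (`d ≥ 1`) in `n` variables over a field with `2 ≠ 0` has a symmetric
determinantal representation with affine entries of some dimension `≤ 4·C(n+d-1, n) - 2`
(`HasSymmDetRepr`). Our dimension is `2·C(n+d-1,n) + 1` for `n ≥ 1, d ≥ 2` (the branching program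
is symmetrised algebraically, each internal vertex doubled) and `1` for affine `p`.
[cite: GrenetEtAl2011, Thm 7] -/
theorem exists_hasSymmDetRepr (h2 : (2 : k) ≠ 0) (n d : ℕ) (hd : 1 ≤ d)
    (p : MvPolynomial (Fin n) k) (hp : p.totalDegree ≤ d) :
    ∃ s ≤ 4 * (n + d - 1).choose n - 2, HasSymmDetRepr p s := by
  obtain ⟨e, rfl⟩ : ∃ e, d = e + 1 := ⟨d - 1, by omega⟩
  rw [show n + (e + 1) - 1 = n + e by omega]
  have hC1 : 1 ≤ (n + e).choose n := Nat.choose_pos (by omega)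
  by_cases h : n = 0 ∨ e = 0
  · -- affine `p`: the `1 × 1` matrix `(p)`
    have hp1 : p.totalDegree ≤ 1 := by
      rcases h with rfl | rfl
      · rw [MvPolynomial.eq_C_of_isEmpty p, totalDegree_C]
        exact Nat.zero_le _
      · simpa using hp
    refine ⟨1, by omega, !![p], ?_, fun i j => ?_, by simp⟩
    · refine Matrix.IsSymm.ext fun i j => ?_
      fin_cases i; fin_cases j; rfl
    · fin_cases i; fin_cases j; simpa using hp1
  · rw [not_or] at h
    obtain ⟨hn, he⟩ := h
    obtain ⟨V, _, _, N, G, a, b, w, hcV, hG, hdet, hN, ha, hb, hw, hv⟩ :=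
      exists_abp_aux (k := k) (n + e) Finset.univ e p (by simp) (Finset.subset_univ _) hp
    simp only [Finset.card_univ, Fintype.card_fin] at hcV
    have hC2 : n + 1 ≤ (n + e).choose n := by
      have := Nat.choose_le_choose n (show n + 1 ≤ n + e by omega)
      rwa [Nat.choose_succ_self_right] at this
    refine ⟨2 * Fintype.card V + 3, by omega, ?_⟩
    rw [← hv]
    exact hasSymmDetRepr_of_abp h2 N G hG hdet a b w hN ha hb hw

end Symmetric

end Thm7

end GKKP2011

/-- **Grenet–Kaltofen–Koiran–Portier 2011, Theorem 7** — discharge of the named fact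
`GKKP2011_thm7`: over a field of characteristic `≠ 2`, every polynomial of total degree `≤ d`
(`d ≥ 1`) in `n` variables has (a) a formula of green size `≤ C(n+d+1,n+1) - C(n+d-1,n+1) - 2`
and (b) a symmetric affine determinantal representation of dimension `≤ 4·C(n+d-1,n) - 2`.
[cite: GrenetEtAl2011, Thm 7] -/
theorem GKKP2011_thm7_holds : GKKP2011_thm7 := by
  intro k _ h2 n d hd p hp
  exact ⟨GKKP2011.Thm7.exists_formula n d hd p hp,
    GKKP2011.Thm7.exists_hasSymmDetRepr h2 n d hd p hp⟩

end Literature.Computability.AlgebraicComplexity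

end
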